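import Literature.Analysis.FluidPDE.SuitableWeakRescaling
import HarnessLib

/-!
# Time translation of suitable weak solutions and weak gradients on slabs

Analysis/FluidPDE theorem file (no new definitions). The accepted covariance of suitable weak
solutions and weak spatial gradients under the space–time affine maps
`Φ(s, y) = (t₀ + β s, x₀ + γ y)` (`IsSuitableWeakSolutionOn.stRescale`,
`HasWeakSpatialGradientOn.stRescale`, `SuitableWeakRescaling.lean`, `SpaceTimeRescaling.lean`;
Caffarelli–Kohn–Nirenberg 1982, §2) contains, for `α = β = γ = 1`, `x₀ = 0`, the invariance
under **time translation** `(s, y) ↦ (t₀ + s, y)`. This file spells that case out for slabs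
`(a, b) × E`, in the form consumed by the concatenation of local energy solutions
(`LocalEnergyConcatenation.lean`): the translated pair `(s, y) ↦ (w(t₀ + s, y), q(t₀ + s, y))`
is a suitable weak solution on `(a − t₀, b − t₀) × E`, with the translated weak gradient, and
space–time (lower) integrals over boxes `(a, b) × K` translate accordingly.

## References

* L. Caffarelli, R. Kohn, L. Nirenberg, CPAM 35 (1982), §2 (invariances of (2.1)–(2.5)).
-/

noncomputable section

open MeasureTheory TopologicalSpace Set Function Filter Metric
open _root_.Topology
open scoped ENNReal NNReal RealInnerProductSpace

namespace Literature.Analysis.FluidPDE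

variable {E : Type*} [NormedAddCommGroup E] [InnerProductSpace ℝ E] [FiniteDimensional ℝ E]
  [MeasurableSpace E] [BorelSpace E]

/-! ## The translated slab -/

omit [FiniteDimensional ℝ E] [MeasurableSpace E] [BorelSpace E] in
/-- The preimage of the slab `(a, b) × E` under the time translation `(s, y) ↦ (t₀ + s, y)` is
the slab `(a − t₀, b − t₀) × E`. [folklore] -/
theorem stPreimage_one_one_slab (t₀ a b : ℝ) :
    stPreimage 1 1 t₀ (0 : E) (slab E (Ioo a b) isOpen_Ioo) = slab E (Ioo (a - t₀) (b - t₀)) isOpen_Ioo := by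
  ext z
  simp only [coe_stPreimage, mem_preimage, SetLike.mem_coe, mem_slab, stAffine_fst, one_mul, mem_Ioo]
  constructor
  · rintro ⟨h1, h2⟩; exact ⟨by linarith, by linarith⟩
  · rintro ⟨h1, h2⟩; exact ⟨by linarith, by linarith⟩

omit [FiniteDimensional ℝ E] [MeasurableSpace E] [BorelSpace E] in
/-- The unit rescaling with time translation is the plain translate: `1 • stPull 1 1 t₀ 0 u = u(t₀ + ·, ·)`.
[folklore] -/
theorem one_smul_stPull_one_one {F : Type*} [NormedAddCommGroup F] [NormedSpace ℝ F] (t₀ : ℝ)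
    (u : ℝ → E → F) : ((1 : ℝ) • stPull 1 1 t₀ (0 : E) u) = fun s y => u (t₀ + s) y := by
  funext s y
  rw [smul_stPull_apply, one_smul, one_mul, one_smul, zero_add]

omit [FiniteDimensional ℝ E] [MeasurableSpace E] [BorelSpace E] in
/-- The same for the weak gradient: `(1 * 1) • stPull 1 1 t₀ 0 G = G(t₀ + ·, ·)`. [folklore] -/
theorem one_mul_one_smul_stPull {F : Type*} [NormedAddCommGroup F] [NormedSpace ℝ F] (t₀ : ℝ)
    (G : ℝ → E → F) : (((1 : ℝ) * 1) • stPull 1 1 t₀ (0 : E) G) = fun s y => G (t₀ + s) y := by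
  rw [one_mul]; exact one_smul_stPull_one_one t₀ G

omit [FiniteDimensional ℝ E] [MeasurableSpace E] [BorelSpace E] in
/-- `1 ^ 2 • stPull 1 1 t₀ 0 p = p(t₀ + ·, ·)`. [folklore] -/
theorem one_sq_smul_stPull {F : Type*} [NormedAddCommGroup F] [NormedSpace ℝ F] (t₀ : ℝ)
    (p : ℝ → E → F) : (((1 : ℝ) ^ 2) • stPull 1 1 t₀ (0 : E) p) = fun s y => p (t₀ + s) y := by
  rw [one_pow]; exact one_smul_stPull_one_one t₀ p

/-! ## Time translation of suitable weak solutions and of weak gradients -/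

/-- **Time translation of suitable weak solutions on a slab** (the case `α = β = γ = 1`,
`x₀ = 0` of `IsSuitableWeakSolutionOn.stRescale`; Caffarelli–Kohn–Nirenberg 1982, §2): if
`(w, q)` is a suitable weak solution of the unforced equations on `(a, b) × E`, then
`(s, y) ↦ (w(t₀ + s, y), q(t₀ + s, y))` is one on `(a − t₀, b − t₀) × E`.
[cite: CaffarelliKohnNirenberg1982, §2] -/
theorem IsSuitableWeakSolutionOn.timeShift {ν a b : ℝ} {w : ℝ → E → E} {q : ℝ → E → ℝ}
    (h : IsSuitableWeakSolutionOn (slab E (Ioo a b) isOpen_Ioo) ν 0 w q) (t₀ : ℝ) :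
    IsSuitableWeakSolutionOn (slab E (Ioo (a - t₀) (b - t₀)) isOpen_Ioo) ν 0
      (fun s y => w (t₀ + s) y) (fun s y => q (t₀ + s) y) := by
  have h1 := h.stRescale one_pos one_pos (show (1 : ℝ) = 1 * 1 by norm_num) t₀ (0 : E)
  rw [stPreimage_one_one_slab, one_smul_stPull_one_one, one_sq_smul_stPull] at h1
  have hν : (1 : ℝ) * ν / 1 = ν := by ring
  have hf : (((1 : ℝ) ^ 2 * 1) • stPull 1 1 t₀ (0 : E) (0 : ℝ → E → E)) = 0 := by
    funext s y; simp [smul_stPull_apply]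
  rw [hν, hf] at h1
  exact h1

/-- **Time translation of weak spatial gradients on a slab** (`α = β = γ = 1`, `x₀ = 0` in
`HasWeakSpatialGradientOn.stRescale`). [cite: CaffarelliKohnNirenberg1982, §2 (2.1)] -/
theorem HasWeakSpatialGradientOn.timeShift {a b : ℝ} {w : ℝ → E → E} {G : ℝ → E → E →L[ℝ] E}
    (h : HasWeakSpatialGradientOn (slab E (Ioo a b) isOpen_Ioo) w G) (t₀ : ℝ) :
    HasWeakSpatialGradientOn (slab E (Ioo (a - t₀) (b - t₀)) isOpen_Ioo)
      (fun s y => w (t₀ + s) y) (fun s y => G (t₀ + s) y) := by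
  have h1 := h.stRescale 1 one_pos one_pos t₀ (0 : E)
  rw [stPreimage_one_one_slab, one_smul_stPull_one_one] at h1
  convert h1 using 1
  funext s y
  simp only [Pi.smul_apply, stPull_apply, one_mul, one_smul, zero_add]

/-! ## Translation of space–time integrals over boxes -/

omit [FiniteDimensional ℝ E] [MeasurableSpace E] [BorelSpace E] in
/-- The preimage of a box `(a, b) × K` under the time translation by `t₀`. [folklore] -/
theorem stAffine_one_one_preimage_prod (t₀ a b : ℝ) (K : Set E) :
    stAffine 1 1 t₀ (0 : E) ⁻¹' (Ioo a b ×ˢ K) = Ioo (a - t₀) (b - t₀) ×ˢ K := by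
  ext z
  simp only [mem_preimage, mem_prod, mem_Ioo, stAffine_fst, stAffine_snd, one_mul, one_smul, zero_add]
  constructor
  · rintro ⟨⟨h1, h2⟩, h3⟩; exact ⟨⟨by linarith, by linarith⟩, h3⟩
  · rintro ⟨⟨h1, h2⟩, h3⟩; exact ⟨⟨by linarith, by linarith⟩, h3⟩

/-- **Lower integrals over boxes are invariant under time translation**:
`∫⁻_{(a−t₀, b−t₀) × K} F(t₀ + s, y) = ∫⁻_{(a, b) × K} F`. [folklore] -/
theorem setLIntegral_prod_timeShift (t₀ a b : ℝ) (K : Set E) (F : ℝ × E → ℝ≥0∞) :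
    ∫⁻ z in Ioo (a - t₀) (b - t₀) ×ˢ K, F (t₀ + z.1, z.2) = ∫⁻ z in Ioo a b ×ˢ K, F z := by
  have h := setLIntegral_preimage_comp_stAffine one_pos one_pos t₀ (0 : E) F (Ioo a b ×ˢ K)
  rw [stAffine_one_one_preimage_prod] at h
  have e : ∀ z : ℝ × E, F (stAffine 1 1 t₀ (0 : E) z) = F (t₀ + z.1, z.2) := fun z => by
    simp only [stAffine, one_mul, one_smul, zero_add]
  simp_rw [e] at h
  rw [h]
  simp

/-- **Bochner integrals over boxes are invariant under time translation**:
`∫_{(a−t₀, b−t₀) × K} F(t₀ + s, y) = ∫_{(a, b) × K} F`. [folklore] -/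
theorem setIntegral_prod_timeShift {G : Type*} [NormedAddCommGroup G] [NormedSpace ℝ G]
    (t₀ a b : ℝ) (K : Set E) (F : ℝ × E → G) :
    ∫ z in Ioo (a - t₀) (b - t₀) ×ˢ K, F (t₀ + z.1, z.2) = ∫ z in Ioo a b ×ˢ K, F z := by
  have h := setIntegral_preimage_comp_stAffine one_pos one_pos t₀ (0 : E) F (Ioo a b ×ˢ K)
  rw [stAffine_one_one_preimage_prod] at h
  have e : ∀ z : ℝ × E, F (stAffine 1 1 t₀ (0 : E) z) = F (t₀ + z.1, z.2) := fun z => by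
    simp only [stAffine, one_mul, one_smul, zero_add]
  simp_rw [e] at h
  rw [h]
  simp

/-- **Integrability on boxes is invariant under time translation.** [folklore] -/
theorem integrableOn_prod_timeShift_iff {G : Type*} [NormedAddCommGroup G] (t₀ a b : ℝ) (K : Set E)
    (F : ℝ × E → G) :
    IntegrableOn (fun z : ℝ × E => F (t₀ + z.1, z.2)) (Ioo (a - t₀) (b - t₀) ×ˢ K) volume ↔
      IntegrableOn F (Ioo a b ×ˢ K) volume := by
  have h := integrableOn_comp_stAffine_iff one_pos one_pos t₀ (0 : E) F (Ioo a b ×ˢ K)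
  rw [stAffine_one_one_preimage_prod] at h
  have e : (F ∘ stAffine 1 1 t₀ (0 : E)) = fun z => F (t₀ + z.1, z.2) := by
    funext z; simp only [Function.comp_apply, stAffine, one_mul, one_smul, zero_add]
  rw [e] at h
  exact h

end Literature.Analysis.FluidPDE
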